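import Literature.MathematicalPhysics.QuantumFieldTheory.Balaban1983to89.T3UnitScaleTilt
import HarnessLib

/-!
# `Balaban1983to89.T3TailTransfer` — rung R3: under K1 ∧ K2 (summable increments) a bound certified at ONE cutoff `K₀` holds at
# EVERY `K ≥ K₀` and in the limit, up to the summable tail `Σ_{i ≥ K₀}(8r_i + 4w_i + 2w'_i)` — the non-Gaussianity / non-triviality
# witness (NT3: a `K`-uniform LOWER bound on a variance-type expectation) becomes ONE finite-lattice computation modulo K1 ∧ K2

Cell `ym3-torus` (HUMAN RULING D-0037, YM ladder rung R3), seat `ym3-torus-p2` gen 3 («non-Gaussianity witness» of the seat's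
purpose).  WHAT THIS IS NOT: not a proof of any lower bound, not NT3, not K1/K2; the input `UnitTiltTail` is the hypothesis
schema of `T3UnitScaleTilt` (the d = 3 expectations step), and the bound at `K₀` is an INPUT (e.g. a certified interval computation
on the lattice `2L^{m+K₀}` per side — a `kit compute` certificate —, or a strong-coupling/cluster-expansion estimate at fixed `K₀`).

* `integral_unitLaw_sub_le_sum` : `|∫W dμ_{K₀+d} − ∫W dμ_{K₀}| ≤ Σ_{i<d} δ(K₀+i)` (telescoping the tree's
  `abs_integral_unitLaw_succ_sub_le`, `δ = 8r + 4w + 2w'`).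
* **`le_integral_unitLaw_of_le_at`** : if `a + Σ'_i δ(K₀+i) ≤ ∫W dμ_{K₀}` then `a ≤ ∫W dμ_K` for every `K ≥ K₀`; and
  **`le_lim_integral_unitLaw_of_le_at`** : the same for the limit (which exists by `exists_tendsto_integral_unitLaw`);
  **`le_expectAt_of_le_at`** : the same for the ORIGINAL family's joint expectations when K1 ∧ K2 hold for the refined family
  (the route's shape), via `expectAt_refine`; `dist_integral_unitLaw_lim_le` : RATE of convergence = the K1 ∧ K2 tail.
So a `K`-UNIFORM lower bound — the shape of the node's NT3 (`T3LoopLawNondegenerate.UniformVariance`, `T3CentreSymmetry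
.uniformVariance_polyakov_iff`: `∀ᶠ K, 2c − 1 ≤ ⟨W̄_{P·P}⟩_K`) — follows from K1 ∧ K2 plus a single finite-`K₀` margin; no further
analytic crux is needed for the fifth (NG/NT) conjunct once the expectations step is in hand ([King1986] (3.13): the same Cauchy
tail controls every bounded observable).
-/

noncomputable section

open MeasureTheory Filter Topology
open Literature.MathematicalPhysics.QuantumFieldTheory.Balaban1983to89.T3ContinuumYM3Torus
open Literature.MathematicalPhysics.QuantumFieldTheory.Balaban1983to89.T3ThresholdRemoval
open Literature.MathematicalPhysics.QuantumFieldTheory.Balaban1983to89.T3UnitScaleTilt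

namespace Literature.MathematicalPhysics.QuantumFieldTheory.Balaban1983to89.T3TailTransfer

variable {F : T3Family} {G : Type*} [GaugeGroup G] [MeasurableSpace G] [HaarData G] [RegularGaugeGroup G]
  {ℰ : LoopAverage G} {γ : ℝ} {r w w' : ℕ → ℝ}

/-- **TELESCOPING THE INCREMENTS**: under `UnitTiltTail` every measurable `|W| ≤ 1` has
`|∫W dμ_{K₀+d} − ∫W dμ_{K₀}| ≤ Σ_{i<d} (8r + 4w + 2w')(K₀+i)`. [cite: King1986, Thm 3.4 (3.13) p.657] -/
theorem integral_unitLaw_sub_le_sum (hE : ℰ.MeasurableE) (hγ : 0 ≤ γ) (h : UnitTiltTail F ℰ γ r w w')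
    {W : GaugeField (F.P 0) 0 G → ℝ} (hWm : Measurable W) (hW1 : ∀ u, |W u| ≤ 1) (K₀ : ℕ) :
    ∀ d : ℕ, |(∫ u, W u ∂F.unitLaw ℰ hE γ (K₀ + d)) - ∫ u, W u ∂F.unitLaw ℰ hE γ K₀| ≤
      ∑ i ∈ Finset.range d, (8 * r (K₀ + i) + 4 * w (K₀ + i) + 2 * w' (K₀ + i))
  | 0 => by simp
  | d + 1 => by
    have ih := integral_unitLaw_sub_le_sum hE hγ h hWm hW1 K₀ d
    have hstep := abs_integral_unitLaw_succ_sub_le hE hγ h hWm hW1 (K₀ + d)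
    rw [Finset.sum_range_succ, show K₀ + (d + 1) = K₀ + d + 1 by omega]
    calc |(∫ u, W u ∂F.unitLaw ℰ hE γ (K₀ + d + 1)) - ∫ u, W u ∂F.unitLaw ℰ hE γ K₀|
        = |((∫ u, W u ∂F.unitLaw ℰ hE γ (K₀ + d + 1)) - ∫ u, W u ∂F.unitLaw ℰ hE γ (K₀ + d)) +
            ((∫ u, W u ∂F.unitLaw ℰ hE γ (K₀ + d)) - ∫ u, W u ∂F.unitLaw ℰ hE γ K₀)| := by ring_nf
      _ ≤ |(∫ u, W u ∂F.unitLaw ℰ hE γ (K₀ + d + 1)) - ∫ u, W u ∂F.unitLaw ℰ hE γ (K₀ + d)| +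
            |(∫ u, W u ∂F.unitLaw ℰ hE γ (K₀ + d)) - ∫ u, W u ∂F.unitLaw ℰ hE γ K₀| := abs_add_le _ _
      _ ≤ _ := by linarith

/-- **A LOWER BOUND CERTIFIED AT ONE CUTOFF HOLDS AT EVERY LATER CUTOFF, UP TO THE SUMMABLE TAIL**: if
`a + Σ'_i δ(K₀+i) ≤ ∫W dμ_{K₀}` (`δ = 8r + 4w + 2w'`, `r, w, w' ≥ 0` summable) then `a ≤ ∫W dμ_K` for all `K ≥ K₀`.
[cite: King1986, Thm 3.4 (3.13) p.657] -/
theorem le_integral_unitLaw_of_le_at (hE : ℰ.MeasurableE) (hγ : 0 ≤ γ) (h : UnitTiltTail F ℰ γ r w w') (hr : Summable r)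
    (hw : Summable w) (hw' : Summable w') (hr0 : ∀ K, 0 ≤ r K) (hw0 : ∀ K, 0 ≤ w K) (hw0' : ∀ K, 0 ≤ w' K) {W : GaugeField (F.P 0) 0 G → ℝ} (hWm : Measurable W)
    (hW1 : ∀ u, |W u| ≤ 1) {K₀ : ℕ} {a : ℝ}
    (ha : a + ∑' i, (8 * r (K₀ + i) + 4 * w (K₀ + i) + 2 * w' (K₀ + i)) ≤ ∫ u, W u ∂F.unitLaw ℰ hE γ K₀) :
    ∀ K, K₀ ≤ K → a ≤ ∫ u, W u ∂F.unitLaw ℰ hE γ K := by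
  intro K hK
  obtain ⟨d, rfl⟩ := Nat.exists_eq_add_of_le hK
  have hδ : Summable fun i => 8 * r (K₀ + i) + 4 * w (K₀ + i) + 2 * w' (K₀ + i) :=
    ((((summable_nat_add_iff K₀).mpr hr).mul_left 8).add (((summable_nat_add_iff K₀).mpr hw).mul_left 4)).add
      (((summable_nat_add_iff K₀).mpr hw').mul_left 2) |>.congr (fun i => by ring_nf)
  have hδ0 : ∀ i, 0 ≤ 8 * r (K₀ + i) + 4 * w (K₀ + i) + 2 * w' (K₀ + i) := fun i => by
    have := hr0 (K₀ + i); have := hw0 (K₀ + i); have := hw0' (K₀ + i); linarith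
  have htele := integral_unitLaw_sub_le_sum hE hγ h hWm hW1 K₀ d
  have hpart : ∑ i ∈ Finset.range d, (8 * r (K₀ + i) + 4 * w (K₀ + i) + 2 * w' (K₀ + i)) ≤
      ∑' i, (8 * r (K₀ + i) + 4 * w (K₀ + i) + 2 * w' (K₀ + i)) :=
    hδ.sum_le_tsum _ fun i _ => hδ0 i
  have := (abs_le.mp (htele.trans hpart)).1
  linarith

/-- **THE SAME FOR THE LIMIT**: the unit-law integrals converge (`exists_tendsto_integral_unitLaw`) and any limit `l` obeys `a ≤ l`
under the finite-`K₀` margin hypothesis — a `K`-uniform, hence limiting, lower bound from ONE certified lattice computation modulo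
K1 ∧ K2. [cite: King1986, Thm 2.1 p.654] -/
theorem le_lim_integral_unitLaw_of_le_at (hE : ℰ.MeasurableE) (hγ : 0 ≤ γ) (h : UnitTiltTail F ℰ γ r w w')
    (hr : Summable r) (hw : Summable w) (hw' : Summable w') (hr0 : ∀ K, 0 ≤ r K) (hw0 : ∀ K, 0 ≤ w K) (hw0' : ∀ K, 0 ≤ w' K)
    {W : GaugeField (F.P 0) 0 G → ℝ} (hWm : Measurable W) (hW1 : ∀ u, |W u| ≤ 1) {K₀ : ℕ} {a : ℝ}
    (ha : a + ∑' i, (8 * r (K₀ + i) + 4 * w (K₀ + i) + 2 * w' (K₀ + i)) ≤ ∫ u, W u ∂F.unitLaw ℰ hE γ K₀)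
    {l : ℝ} (hl : Tendsto (fun K => ∫ u, W u ∂F.unitLaw ℰ hE γ K) atTop (𝓝 l)) : a ≤ l :=
  ge_of_tendsto hl (Filter.eventually_atTop.mpr ⟨K₀, le_integral_unitLaw_of_le_at hE hγ h hr hw hw' hr0 hw0 hw0' hWm hW1 ha⟩)

/-- **RATE OF CONVERGENCE = THE K1 ∧ K2 TAIL**: the limit `l` of the unit-law integrals of a measurable `|W| ≤ 1` satisfies
`|∫W dμ_{K₀} − l| ≤ Σ'_i (8r + 4w + 2w')(K₀ + i)` for every `K₀` — the continuum limit is reached at the rate of the tilt radii and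
the history tails ([King1986] (3.13)). [cite: King1986, Thm 3.4 (3.13) p.657] -/
theorem dist_integral_unitLaw_lim_le (hE : ℰ.MeasurableE) (hγ : 0 ≤ γ) (h : UnitTiltTail F ℰ γ r w w')
    (hr : Summable r) (hw : Summable w) (hw' : Summable w') {W : GaugeField (F.P 0) 0 G → ℝ} (hWm : Measurable W)
    (hW1 : ∀ u, |W u| ≤ 1) {l : ℝ} (hl : Tendsto (fun K => ∫ u, W u ∂F.unitLaw ℰ hE γ K) atTop (𝓝 l)) (K₀ : ℕ) :
    dist (∫ u, W u ∂F.unitLaw ℰ hE γ K₀) l ≤ ∑' i, (8 * r (K₀ + i) + 4 * w (K₀ + i) + 2 * w' (K₀ + i)) :=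
  dist_le_tsum_of_dist_le_of_tendsto (f := fun K => ∫ u, W u ∂F.unitLaw ℰ hE γ K)
    (fun K => 8 * r K + 4 * w K + 2 * w' K)
    (fun K => by
      rw [Real.dist_eq, abs_sub_comm]
      exact abs_integral_unitLaw_succ_sub_le hE hγ h hWm hW1 K)
    (((hr.mul_left 8).add (hw.mul_left 4)).add (hw'.mul_left 2)) hl K₀

/-- **AT THE LEVEL OF THE SCHEME'S EXPECTATIONS, WITH THE ROUTE'S REFINEMENT**: if K1 ∧ K2 hold at the unit lattice of the
refined family `F.refine n` at `γL^{-n}` (the shape the route's cruxes deliver below their thresholds), then a lower bound on a joint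
expectation `⟨∏_{C∈Cs} W̄_C⟩` of the ORIGINAL family certified at the single cutoff `K₀ + n` with margin `Σ'_i δ(K₀+i)` holds at every
cutoff `K + n`, `K ≥ K₀` (tree `expectAt_refine`: these expectations are integrals of the bounded measurable `coarseObs` against the
refined unit laws). [cite: King1986, Thm 3.4 (3.13) p.657] -/
theorem le_expectAt_of_le_at (hE : ℰ.MeasurableE) (n : ℕ) (hγ : 0 ≤ γ)
    (h : UnitTiltTail (F.refine n) ℰ (γ * ((F.L : ℝ)⁻¹) ^ n) r w w') (hr : Summable r) (hw : Summable w)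
    (hw' : Summable w') (hr0 : ∀ K, 0 ≤ r K) (hw0 : ∀ K, 0 ≤ w K) (hw0' : ∀ K, 0 ≤ w' K) (Cs : List (ULoop3 F))
    {K₀ : ℕ} {a : ℝ}
    (ha : a + ∑' i, (8 * r (K₀ + i) + 4 * w (K₀ + i) + 2 * w' (K₀ + i)) ≤ (F.scheme ℰ γ).expectAt (K₀ + n) Cs) :
    ∀ K, K₀ ≤ K → a ≤ (F.scheme ℰ γ).expectAt (K + n) Cs := by
  have hγ' : 0 ≤ γ * ((F.L : ℝ)⁻¹) ^ n := mul_nonneg hγ (pow_nonneg (inv_nonneg.mpr (Nat.cast_nonneg _)) n)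
  intro K hK
  rw [expectAt_refine F n ℰ hE hγ K Cs]
  rw [expectAt_refine F n ℰ hE hγ K₀ Cs] at ha
  exact le_integral_unitLaw_of_le_at hE hγ' h hr hw hw' hr0 hw0 hw0' (measurable_coarseObs F n ℰ hE Cs)
    (abs_coarseObs_le_one F n ℰ Cs) ha K hK

end Literature.MathematicalPhysics.QuantumFieldTheory.Balaban1983to89.T3TailTransfer

end
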